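import Summits.CriticalPhenomena.PercolationContinuityZ3.Theorems.Transplant.FKConnectivityAllQAntipodalCellAlgebra
import HarnessLib

/-!
# Connectivity correlation inequalities for `φ_{w,q}`, every `q > 0` — file 47: the LAYER-CAKE reduction — an antipodal inequality for every
# UP-SET indicator on `S` implies it for every INCREASING function reading only `S`

Support file (`--supports stmt-CriticalPhenomena-4575`), FK sub-lane `prim-bschramm-fk-2` (gen 21); builds on p205010 (kernel theorem,
internal audit signed; external expert review pending).  No definitions, no named facts, no sorries; standard axioms.

**`FK.apPsiC_nonpos_of_upsets`**: if `apPsiC q M C h g ≤ 0` for every `{0,1}`-valued `h` that is increasing on the subsets of `S` and reads no edge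
outside `S`, then `apPsiC q M C f g ≤ 0` for every real `f` increasing on the subsets of `S` and reading no edge outside `S`.  Proof: peel the
layer cake — subtract `(a − m)·1{f ≥ a}` with `m = f ∅` the bottom value and `a` the next value; the remainder is again increasing, reads only
`S`, and takes the value `a` nowhere, so an induction on the number of subsets of `S` where `f` exceeds `f ∅` concludes (`FK.apPsiC` is linear in
`f`).  This is the reduction behind "level `n` for EVERY increasing `f`" statements (g20 §10 item 1: level 4 needs it together with the 80
up-set certificates); it is `q`-, host- and cell-independent.
[cite: Grimmett2006, §2.1 (increasing events and functions) (pp. 18–19); §3.9 (pp. 63–64)]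
-/

noncomputable section

namespace Summit.CriticalPhenomena.PercolationContinuityZ3.Theorems

namespace FK

open Literature.Probability.LatticeModels Literature.Probability.Percolation
open scoped Classical

variable {V : Type*}

/-- `apPsiC` of a difference with a scalar multiple: `apPsiC (f − c·h) = apPsiC f − c·apPsiC h`. [folklore] -/
theorem apPsiC_sub_smul_left (q : ℝ) (M C : Finset (Sym2 V)) (c : ℝ) (f h g : Finset (Sym2 V) → ℝ) :
    apPsiC q M C (fun A => f A - c * h A) g = apPsiC q M C f g - c * apPsiC q M C h g := by
  unfold apPsiC
  rw [Finset.mul_sum, ← Finset.sum_sub_distrib]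
  exact Finset.sum_congr rfl fun γ _ => by ring

/-- A function that reads no edge outside `S` and is constant on the subsets of `S` has vanishing antipodal form. [folklore] -/
theorem apPsiC_eq_zero_of_const_on {q : ℝ} {M C S : Finset (Sym2 V)} {f : Finset (Sym2 V) → ℝ}
    (hf : ∀ e : Sym2 V, e ∉ S → ∀ A : Finset (Sym2 V), f (insert e A) = f A) (hc : ∀ A : Finset (Sym2 V), A ⊆ S → f A = f ∅)
    (g : Finset (Sym2 V) → ℝ) : apPsiC q M C f g = 0 := by
  have hfS := eq_inter_of_notRead_outside hf
  unfold apPsiC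
  refine Finset.sum_eq_zero fun γ _ => ?_
  rw [hfS (γ ∪ C), hfS (M \ γ ∪ C), hc _ Finset.inter_subset_right, hc _ Finset.inter_subset_right, sub_self, zero_mul, mul_zero]

/-- **LAYER-CAKE REDUCTION.**  Let `S` be a finite edge set, `M, C` a cell, `q` real, `g` any test function.  If `apPsiC q M C h g ≤ 0` for every
`h` that reads no edge outside `S`, is increasing on the subsets of `S` and takes only the values `0, 1` there, then `apPsiC q M C f g ≤ 0` for
every `f` that reads no edge outside `S` and is increasing on the subsets of `S`.
[cite: Grimmett2006, §2.1 (pp. 18–19); §3.9 (pp. 63–64)] -/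
theorem apPsiC_nonpos_of_upsets {q : ℝ} {M C S : Finset (Sym2 V)} {g : Finset (Sym2 V) → ℝ}
    (H : ∀ h : Finset (Sym2 V) → ℝ, (∀ e : Sym2 V, e ∉ S → ∀ A : Finset (Sym2 V), h (insert e A) = h A) →
      (∀ ⦃A B : Finset (Sym2 V)⦄, A ⊆ B → B ⊆ S → h A ≤ h B) → (∀ A : Finset (Sym2 V), A ⊆ S → h A = 0 ∨ h A = 1) →
      apPsiC q M C h g ≤ 0) :
    ∀ (n : ℕ) (f : Finset (Sym2 V) → ℝ), (S.powerset.filter fun A => f ∅ < f A).card ≤ n →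
      (∀ e : Sym2 V, e ∉ S → ∀ A : Finset (Sym2 V), f (insert e A) = f A) →
      (∀ ⦃A B : Finset (Sym2 V)⦄, A ⊆ B → B ⊆ S → f A ≤ f B) → apPsiC q M C f g ≤ 0 := by
  intro n
  induction n with
  | zero =>
    intro f hcard hf hmono
    rw [Nat.le_zero, Finset.card_eq_zero, Finset.filter_eq_empty_iff] at hcard
    have hc : ∀ A : Finset (Sym2 V), A ⊆ S → f A = f ∅ := fun A hA =>
      le_antisymm (not_lt.1 (hcard (Finset.mem_powerset.2 hA))) (hmono (Finset.empty_subset A) hA)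
    exact (apPsiC_eq_zero_of_const_on hf hc g).le
  | succ n ih =>
    intro f hcard hf hmono
    by_cases h0 : (S.powerset.filter fun A => f ∅ < f A) = ∅
    · exact ih f (by rw [h0, Finset.card_empty]; exact Nat.zero_le _) hf hmono
    -- the next value `a` above the bottom value `m = f ∅`
    obtain ⟨A₀, hA₀⟩ := Finset.nonempty_iff_ne_empty.2 h0
    set P := S.powerset.filter fun A => f ∅ < f A with hP
    have hPne : (P.image f).Nonempty := ⟨f A₀, Finset.mem_image_of_mem f hA₀⟩
    set a := (P.image f).min' hPne with ha
    have ha_mem : a ∈ P.image f := Finset.min'_mem _ hPne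
    obtain ⟨A₁, hA₁P, hA₁a⟩ := Finset.mem_image.1 ha_mem
    have hma : f ∅ < a := by rw [← hA₁a]; exact (Finset.mem_filter.1 hA₁P).2
    have ha_le : ∀ A : Finset (Sym2 V), A ⊆ S → f ∅ < f A → a ≤ f A := fun A hA hlt =>
      Finset.min'_le _ _ (Finset.mem_image_of_mem f (Finset.mem_filter.2 ⟨Finset.mem_powerset.2 hA, hlt⟩))
    -- the up-set indicator `h = 1{a ≤ f(· ∩ S)}` and the peeled function `f' = f − (a − m) h`
    have hfS := eq_inter_of_notRead_outside hf
    set h : Finset (Sym2 V) → ℝ := fun A => if a ≤ f (A ∩ S) then 1 else 0 with hh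
    have hread : ∀ e : Sym2 V, e ∉ S → ∀ A : Finset (Sym2 V), h (insert e A) = h A := fun e he A => by
      simp only [hh, Finset.insert_inter_of_notMem he]
    have hmono_h : ∀ ⦃A B : Finset (Sym2 V)⦄, A ⊆ B → B ⊆ S → h A ≤ h B := fun A B hAB hB => by
      simp only [hh, Finset.inter_eq_left.2 (hAB.trans hB), Finset.inter_eq_left.2 hB]
      by_cases h1 : a ≤ f A
      · rw [if_pos h1, if_pos (h1.trans (hmono hAB hB))]
      · rw [if_neg h1]; split_ifs <;> norm_num
    have h01 : ∀ A : Finset (Sym2 V), A ⊆ S → h A = 0 ∨ h A = 1 := fun A _ => by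
      simp only [hh]; split_ifs
      · exact Or.inr rfl
      · exact Or.inl rfl
    have Hh := H h hread hmono_h h01
    set f' : Finset (Sym2 V) → ℝ := fun A => f A - (a - f ∅) * h A with hf'
    have hread' : ∀ e : Sym2 V, e ∉ S → ∀ A : Finset (Sym2 V), f' (insert e A) = f' A := fun e he A => by
      simp only [hf', hf e he A, hread e he A]
    -- values of `f'` on subsets of `S`
    have hval : ∀ A : Finset (Sym2 V), A ⊆ S → f' A = (if a ≤ f A then f A - (a - f ∅) else f A) := fun A hA => by
      simp only [hf', hh, Finset.inter_eq_left.2 hA]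
      split_ifs <;> ring
    have hempty : f' ∅ = f ∅ := by
      rw [hval ∅ (Finset.empty_subset _), if_neg (not_le.2 hma)]
    have hmono' : ∀ ⦃A B : Finset (Sym2 V)⦄, A ⊆ B → B ⊆ S → f' A ≤ f' B := fun A B hAB hB => by
      rw [hval A (hAB.trans hB), hval B hB]
      have hfAB := hmono hAB hB
      by_cases h1 : a ≤ f A
      · rw [if_pos h1, if_pos (h1.trans hfAB)]; linarith
      · rw [if_neg h1]
        by_cases h2 : a ≤ f B
        · rw [if_pos h2]
          -- f A < a: then f A = f ∅ (no value strictly between)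
          have hA0 : f A = f ∅ := by
            by_contra hne
            exact h1 (ha_le A (hAB.trans hB) (lt_of_le_of_ne (hmono (Finset.empty_subset A) (hAB.trans hB)) (Ne.symm hne)))
          linarith
        · rw [if_neg h2]; exact hfAB
    -- the exceedance set of `f'` is strictly smaller: `A₁` leaves it
    have hsub : (S.powerset.filter fun A => f' ∅ < f' A) ⊆ P.erase A₁ := by
      intro A hA
      rw [Finset.mem_filter] at hA
      have hAS : A ⊆ S := Finset.mem_powerset.1 hA.1
      have hlt := hA.2
      rw [hempty, hval A hAS] at hlt
      refine Finset.mem_erase.2 ⟨?_, Finset.mem_filter.2 ⟨hA.1, ?_⟩⟩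
      · rintro rfl
        rw [if_pos (le_of_eq hA₁a.symm), hA₁a] at hlt
        linarith
      · by_cases h1 : a ≤ f A
        · exact lt_of_lt_of_le hma h1
        · rw [if_neg h1] at hlt; exact hlt
    have hcard' : (S.powerset.filter fun A => f' ∅ < f' A).card ≤ n := by
      have h1 := Finset.card_le_card hsub
      have h2 := Finset.card_erase_of_mem hA₁P
      have h3 : P.card ≤ n + 1 := hcard
      omega
    have key := ih f' hcard' hread' hmono'
    have hlin : apPsiC q M C f' g = apPsiC q M C f g - (a - f ∅) * apPsiC q M C h g := apPsiC_sub_smul_left q M C _ f h g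
    rw [hlin] at key
    nlinarith

/-- **LAYER-CAKE REDUCTION (packaged).**  Under the hypothesis of `FK.apPsiC_nonpos_of_upsets` on up-set indicators, every `f` increasing on the
subsets of `S` and reading no other edge has `apPsiC q M C f g ≤ 0`. [cite: Grimmett2006, §2.1 (pp. 18–19); §3.9 (pp. 63–64)] -/
theorem apPsiC_nonpos_of_upsets' {q : ℝ} {M C S : Finset (Sym2 V)} {g : Finset (Sym2 V) → ℝ}
    (H : ∀ h : Finset (Sym2 V) → ℝ, (∀ e : Sym2 V, e ∉ S → ∀ A : Finset (Sym2 V), h (insert e A) = h A) →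
      (∀ ⦃A B : Finset (Sym2 V)⦄, A ⊆ B → B ⊆ S → h A ≤ h B) → (∀ A : Finset (Sym2 V), A ⊆ S → h A = 0 ∨ h A = 1) →
      apPsiC q M C h g ≤ 0)
    {f : Finset (Sym2 V) → ℝ} (hf : ∀ e : Sym2 V, e ∉ S → ∀ A : Finset (Sym2 V), f (insert e A) = f A)
    (hmono : ∀ ⦃A B : Finset (Sym2 V)⦄, A ⊆ B → B ⊆ S → f A ≤ f B) : apPsiC q M C f g ≤ 0 :=
  apPsiC_nonpos_of_upsets H _ f le_rfl hf hmono

end FK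

end Summit.CriticalPhenomena.PercolationContinuityZ3.Theorems

end
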